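import Summits.CriticalPhenomena.PercolationContinuityZ3.Theorems.PercNearOneGluingNoHeavyLowerTailKnQuestion8CoefficientwiseCoreClassKernelMixHubPathPrep
import HarnessLib

/-!
# Embedding words into the augmented family (PATH LEMMA of hub-Kleitman, memo §1.6: BB ↦ D, RB ↦ {0} ∪ D, BR ↦ D ∪ {ℓ})

Support file (`--supports stmt-CriticalPhenomena-4575`, closed), prover `prim-cplus-coupling` (gen 51).  No definitions, no notations,
no named facts, no sorries; standard axioms.  Memo `prim-cplus-coupling/A5-COUPLING-gen51.md` §1.6.

The even family `F` of `…KernelMixHubClosed.hubStair_matching_closed` (hypothesis `hF`, N = ℓ) and the SOURCES `S` of the path lemma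
(hypothesis `hS`: BB words with `D = ∅` or `cell(D)` in the staircase, RB words with `cell(D) ∈ A`, BR words with `cell(D) ∈ B`).
* readers of the family: `hubPath_family_inner` / `_zero` / `_top` / `_le` (which clause a member is in, by `0 ∈ E`, `ℓ ∈ E`);
* `hubPath_emb_family` — the source embedding `emb` (hypothesis `hemb`: BB ↦ `D`, RB ↦ `insert 0 D`, BR ↦ `insert ℓ D`) maps sources
  into `F` (parities by `hubPath_even_walls_iff`);
* `hubPath_emb_inj` — `emb` is injective on sources (first colour and walls are recovered; `walls_ext`).
Used by `…KernelMixHubPathCore`.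
[cite: KozmaNitzan2024, Questions 8–9 (§5.5 p. 36) (context)]
-/

namespace Summit.CriticalPhenomena.PercolationContinuityZ3.Theorems

open Finset
open scoped symmDiff

namespace Coefficientwise

/-- Reader: a member of the even family avoiding `0` and `ℓ` is empty or an inner set of the staircase. [folklore] -/
theorem hubPath_family_inner (ℓ : ℕ) (om : ℕ → ℕ) (A B : Finset (ℕ × ℕ)) (F : Finset ℕ → Prop)
    (hF : ∀ E, F E ↔ Even E.card ∧ (E = ∅ ∨
       (0 ∉ E ∧ ℓ ∉ E ∧ (∀ e ∈ E, e ≤ ℓ - 1) ∧ ∃ h : E.Nonempty, E.max' h ≤ om (E.min' h)) ∨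
       (0 ∈ E ∧ ℓ ∉ E ∧ ∃ h : (E.erase 0).Nonempty, ((E.erase 0).min' h, (E.erase 0).max' h) ∈ A) ∨
       (ℓ ∈ E ∧ 0 ∉ E ∧ ∃ h : (E.erase ℓ).Nonempty, ((E.erase ℓ).min' h, (E.erase ℓ).max' h) ∈ B)))
    (X : Finset ℕ) (hX : F X) (h0 : 0 ∉ X) (hl : ℓ ∉ X) :
    X = ∅ ∨ ∃ h : X.Nonempty, X.max' h ≤ om (X.min' h) := by
  obtain ⟨_, h | ⟨_, _, _, h⟩ | ⟨h, _⟩ | ⟨h, _⟩⟩ := (hF X).mp hX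
  · exact Or.inl h
  · exact Or.inr h
  · exact absurd h h0
  · exact absurd h hl

/-- Reader: a member containing `0` avoids `ℓ` and has `cell(E ∖ 0) ∈ A` (stated for any name `Y` of `E ∖ 0`). [folklore] -/
theorem hubPath_family_zero (ℓ : ℕ) (om : ℕ → ℕ) (A B : Finset (ℕ × ℕ)) (F : Finset ℕ → Prop)
    (hF : ∀ E, F E ↔ Even E.card ∧ (E = ∅ ∨
       (0 ∉ E ∧ ℓ ∉ E ∧ (∀ e ∈ E, e ≤ ℓ - 1) ∧ ∃ h : E.Nonempty, E.max' h ≤ om (E.min' h)) ∨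
       (0 ∈ E ∧ ℓ ∉ E ∧ ∃ h : (E.erase 0).Nonempty, ((E.erase 0).min' h, (E.erase 0).max' h) ∈ A) ∨
       (ℓ ∈ E ∧ 0 ∉ E ∧ ∃ h : (E.erase ℓ).Nonempty, ((E.erase ℓ).min' h, (E.erase ℓ).max' h) ∈ B)))
    (X Y : Finset ℕ) (hX : F X) (h0 : 0 ∈ X) (hY : X.erase 0 = Y) :
    ℓ ∉ X ∧ ∃ h : Y.Nonempty, (Y.min' h, Y.max' h) ∈ A := by
  subst hY
  obtain ⟨_, h | ⟨h, _⟩ | ⟨_, hl, h⟩ | ⟨_, h, _⟩⟩ := (hF X).mp hX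
  · rw [h] at h0; simp at h0
  · exact absurd h0 h
  · exact ⟨hl, h⟩
  · exact absurd h0 h

/-- Reader: a member containing `ℓ` avoids `0` and has `cell(E ∖ ℓ) ∈ B` (stated for any name `Y` of `E ∖ ℓ`). [folklore] -/
theorem hubPath_family_top (ℓ : ℕ) (om : ℕ → ℕ) (A B : Finset (ℕ × ℕ)) (F : Finset ℕ → Prop)
    (hF : ∀ E, F E ↔ Even E.card ∧ (E = ∅ ∨
       (0 ∉ E ∧ ℓ ∉ E ∧ (∀ e ∈ E, e ≤ ℓ - 1) ∧ ∃ h : E.Nonempty, E.max' h ≤ om (E.min' h)) ∨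
       (0 ∈ E ∧ ℓ ∉ E ∧ ∃ h : (E.erase 0).Nonempty, ((E.erase 0).min' h, (E.erase 0).max' h) ∈ A) ∨
       (ℓ ∈ E ∧ 0 ∉ E ∧ ∃ h : (E.erase ℓ).Nonempty, ((E.erase ℓ).min' h, (E.erase ℓ).max' h) ∈ B)))
    (X Y : Finset ℕ) (hX : F X) (hl : ℓ ∈ X) (hY : X.erase ℓ = Y) :
    0 ∉ X ∧ ∃ h : Y.Nonempty, (Y.min' h, Y.max' h) ∈ B := by
  subst hY
  obtain ⟨_, h | ⟨_, h, _⟩ | ⟨_, h, _⟩ | ⟨_, h0, h⟩⟩ := (hF X).mp hX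
  · rw [h] at hl; simp at hl
  · exact absurd hl h
  · exact absurd hl h
  · exact ⟨h0, h⟩

/-- Reader: members of the family lie in `[0, ℓ]`. [folklore] -/
theorem hubPath_family_le (ℓ : ℕ) (om : ℕ → ℕ) (A B : Finset (ℕ × ℕ))
    (hAcell : ∀ c ∈ A, 1 ≤ c.1 ∧ c.1 ≤ c.2 ∧ c.2 ≤ ℓ - 1 ∧ c.2 ≤ om c.1)
    (hBcell : ∀ c ∈ B, 1 ≤ c.1 ∧ c.1 ≤ c.2 ∧ c.2 ≤ ℓ - 1 ∧ c.2 ≤ om c.1) (F : Finset ℕ → Prop)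
    (hF : ∀ E, F E ↔ Even E.card ∧ (E = ∅ ∨
       (0 ∉ E ∧ ℓ ∉ E ∧ (∀ e ∈ E, e ≤ ℓ - 1) ∧ ∃ h : E.Nonempty, E.max' h ≤ om (E.min' h)) ∨
       (0 ∈ E ∧ ℓ ∉ E ∧ ∃ h : (E.erase 0).Nonempty, ((E.erase 0).min' h, (E.erase 0).max' h) ∈ A) ∨
       (ℓ ∈ E ∧ 0 ∉ E ∧ ∃ h : (E.erase ℓ).Nonempty, ((E.erase ℓ).min' h, (E.erase ℓ).max' h) ∈ B)))
    (X : Finset ℕ) (hX : F X) : ∀ e ∈ X, e ≤ ℓ := by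
  intro e he
  obtain ⟨_, h | ⟨_, _, hle, _⟩ | ⟨_, _, hne, hA⟩ | ⟨_, _, hne, hB⟩⟩ := (hF X).mp hX
  · rw [h] at he; simp at he
  · have := hle e he; omega
  · by_cases he0 : e = 0
    · omega
    · have hc := hAcell _ hA
      have := (X.erase 0).le_max' e (Finset.mem_erase.mpr ⟨he0, he⟩)
      simp only at hc
      omega
  · by_cases hel : e = ℓ
    · omega
    · have hc := hBcell _ hB
      have := (X.erase ℓ).le_max' e (Finset.mem_erase.mpr ⟨hel, he⟩)
      simp only at hc
      omega

/-- **Sources embed into the even family** (memo §1.6): BB ↦ `D`, RB ↦ `{0} ∪ D`, BR ↦ `D ∪ {ℓ}`. [folklore] -/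
theorem hubPath_emb_family (ℓ : ℕ) (hℓ : 2 ≤ ℓ) (om : ℕ → ℕ) (A B : Finset (ℕ × ℕ)) (F : Finset ℕ → Prop)
    (hF : ∀ E, F E ↔ Even E.card ∧ (E = ∅ ∨
       (0 ∉ E ∧ ℓ ∉ E ∧ (∀ e ∈ E, e ≤ ℓ - 1) ∧ ∃ h : E.Nonempty, E.max' h ≤ om (E.min' h)) ∨
       (0 ∈ E ∧ ℓ ∉ E ∧ ∃ h : (E.erase 0).Nonempty, ((E.erase 0).min' h, (E.erase 0).max' h) ∈ A) ∨
       (ℓ ∈ E ∧ 0 ∉ E ∧ ∃ h : (E.erase ℓ).Nonempty, ((E.erase ℓ).min' h, (E.erase ℓ).max' h) ∈ B)))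
    (D : Finset ℕ → Finset ℕ) (hD : ∀ ω, D ω = (Icc 1 (ℓ - 1)).filter (fun k => ¬ (k ∈ ω ↔ k + 1 ∈ ω)))
    (S : Finset ℕ → Prop)
    (hS : ∀ ω, S ω ↔ ω ⊆ Icc 1 ℓ ∧
       ((1 ∉ ω ∧ ℓ ∉ ω ∧ (D ω = ∅ ∨ ∃ h : (D ω).Nonempty, (D ω).max' h ≤ om ((D ω).min' h))) ∨
        (1 ∈ ω ∧ ℓ ∉ ω ∧ ∃ h : (D ω).Nonempty, ((D ω).min' h, (D ω).max' h) ∈ A) ∨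
        (1 ∉ ω ∧ ℓ ∈ ω ∧ ∃ h : (D ω).Nonempty, ((D ω).min' h, (D ω).max' h) ∈ B)))
    (emb : Finset ℕ → Finset ℕ)
    (hemb : ∀ ω, emb ω = if 1 ∈ ω then insert 0 (D ω) else if ℓ ∈ ω then insert ℓ (D ω) else D ω)
    (ω : Finset ℕ) (hSω : S ω) : F (emb ω) := by
  have hℓ1 : 1 ≤ ℓ := by omega
  have hD0 := hubPath_zero_notMem_walls ℓ D hD
  have hDℓ := hubPath_top_notMem_walls ℓ hℓ1 D hD
  obtain ⟨_, hcase⟩ := (hS ω).mp hSω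
  have hpar := hubPath_even_walls_iff ℓ hℓ1 D hD ω
  rw [hF, hemb]
  rcases hcase with ⟨h1, hl, hR⟩ | ⟨h1, hl, hA⟩ | ⟨h1, hl, hB⟩
  · rw [if_neg h1, if_neg hl]
    refine ⟨hpar.mpr (iff_of_false h1 hl), ?_⟩
    rcases hR with h0 | ⟨h, hR⟩
    · exact Or.inl h0
    · exact Or.inr (Or.inl ⟨hD0 ω, hDℓ ω, hubPath_walls_le ℓ D hD ω, h, hR⟩)
  · rw [if_pos h1]
    refine ⟨?_, Or.inr (Or.inr (Or.inl ⟨Finset.mem_insert_self _ _, ?_, ?_⟩))⟩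
    · rw [Finset.card_insert_of_notMem (hD0 ω), Nat.even_add_one, hpar]
      tauto
    · rw [Finset.mem_insert]
      push Not
      exact ⟨by omega, hDℓ ω⟩
    · rw [Finset.erase_insert (hD0 ω)]
      exact hA
  · rw [if_neg h1, if_pos hl]
    refine ⟨?_, Or.inr (Or.inr (Or.inr ⟨Finset.mem_insert_self _ _, ?_, ?_⟩))⟩
    · rw [Finset.card_insert_of_notMem (hDℓ ω), Nat.even_add_one, hpar]
      tauto
    · rw [Finset.mem_insert]
      push Not
      exact ⟨by omega, hD0 ω⟩
    · rw [Finset.erase_insert (hDℓ ω)]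
      exact hB

/-- **The source embedding is injective** on words in `[1, ℓ]` (`ℓ ≥ 2`): `0 ∈ emb ω` reads the first colour, the rest reads the walls.
[folklore] -/
theorem hubPath_emb_inj (ℓ : ℕ) (hℓ : 2 ≤ ℓ)
    (D : Finset ℕ → Finset ℕ) (hD : ∀ ω, D ω = (Icc 1 (ℓ - 1)).filter (fun k => ¬ (k ∈ ω ↔ k + 1 ∈ ω)))
    (emb : Finset ℕ → Finset ℕ)
    (hemb : ∀ ω, emb ω = if 1 ∈ ω then insert 0 (D ω) else if ℓ ∈ ω then insert ℓ (D ω) else D ω)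
    (ω₁ ω₂ : Finset ℕ) (h₁ : ω₁ ⊆ Icc 1 ℓ) (h₂ : ω₂ ⊆ Icc 1 ℓ) (h : emb ω₁ = emb ω₂) : ω₁ = ω₂ := by
  have hℓ1 : 1 ≤ ℓ := by omega
  have hD0 := hubPath_zero_notMem_walls ℓ D hD
  have hDℓ := hubPath_top_notMem_walls ℓ hℓ1 D hD
  have e0 : ∀ ω, (0 ∈ emb ω ↔ 1 ∈ ω) := by
    intro ω
    rw [hemb]
    split_ifs with h1 hl
    · exact iff_of_true (Finset.mem_insert_self _ _) h1
    · rw [Finset.mem_insert]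
      constructor
      · rintro (h | h)
        · omega
        · exact absurd h (hD0 ω)
      · intro h; exact absurd h h1
    · exact iff_of_false (hD0 ω) h1
  have eD : ∀ ω, ((emb ω).erase 0).erase ℓ = D ω := by
    intro ω
    rw [hemb]
    split_ifs with h1 hl
    · rw [Finset.erase_insert (hD0 ω), Finset.erase_eq_of_notMem (hDℓ ω)]
    · have h0 : (0 : ℕ) ∉ insert ℓ (D ω) := by
        rw [Finset.mem_insert]; push Not; exact ⟨by omega, hD0 ω⟩
      rw [Finset.erase_eq_of_notMem h0, Finset.erase_insert (hDℓ ω)]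
    · rw [Finset.erase_eq_of_notMem (hD0 ω), Finset.erase_eq_of_notMem (hDℓ ω)]
  have hfirst : (1 ∈ ω₁ ↔ 1 ∈ ω₂) := by rw [← e0, ← e0, h]
  have hwalls : D ω₁ = D ω₂ := by rw [← eD, ← eD, h]
  exact walls_ext ℓ D hD ω₁ ω₂ h₁ h₂ hfirst hwalls

end Coefficientwise

end Summit.CriticalPhenomena.PercolationContinuityZ3.Theorems
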